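import Mathlib
import Summits.Ventures.PercRepro.PuncturedLYMRowsLogConcave

/-!
# PercRepro — THE SURVIVAL FRACTION OF A PAIRWISE DISJOINT FAMILY IS LOG-CONCAVE (IFR)
(p10, gen 38)

For a family `𝒞` of pairwise disjoint members on `S` (`#S = n`) with rows `r t = #rowsOf S t 𝒞`, the SURVIVAL FRACTION
`r t / C(n, t)` (the probability that a random `t`-subset contains no member) is log-concave in `t`; equivalently the
HAZARD of the random chain — the probability that the `(t+1)`-th point completes a member, given that no member is
complete yet — is increasing.  THEOREM (`ifr_rowsOf`), in the binomial-free form used by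
`NodeArith.first_family_of_ifr`: `(t+2)(n−t) · r t · r (t+2) ≤ (t+1)(n−t−1) · r (t+1)²`.
PROOF. (1) THE HAZARD IDENTITY (`hazard_identity`): `(n − t) · r t = (t+1) · r (t+1) + Σ_C A_C t`, where `A_C t` counts
the rows of level `t` one point short of the member `C` (`#(X ∩ C) + 1 = #C`) — a double count of the pairs `(X, z)`,
`X` a row, `z ∉ X`: `insert z X` is a row (`(t+1) · r (t+1)` such pairs) or completes exactly one member `C`, which is
then one short in `X` with `z` its missing point.  (2) `A_C t = #C · r' (t + 1 − #C)` with `r'` the rows of the other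
members on `S ∖ C` (`rows_insert_fiber_eq_image`), and `r t` is the convolution of the truncated binomial row of `C`
with `r'` (`rowsSeq_insert`); the log-concavity of `r'` (`glc_rowsSeq`) gives `A_C (t+1) · r t ≥ A_C t · r (t+1)`
termwise (`A_step`), hence for the sums.  (3) Substituting the identity at `t` and `t + 1` gives the theorem.
Nothing here asserts (SP).
-/

namespace PercRepro.PuncturedLYM.Split

open Finset LogConcave

variable {α : Type} [DecidableEq α]

/-- The rows of level `t` one point short of the member `C`. -/
def shortRows (S : Finset α) (t : ℕ) (𝒞 : Finset (Finset α)) (C : Finset α) : Finset (Finset α) :=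
  (rowsOf S t 𝒞).filter (fun X => (X ∩ C).card + 1 = C.card)

section Hazard

variable {S : Finset α} {𝒞 : Finset (Finset α)} {t : ℕ}

/-- A subset of a row is a row (at its own level). -/
theorem mem_rowsOf_of_subset {X Y : Finset α} (hY : Y ∈ rowsOf S (t + 1) 𝒞) (hX : X ⊆ Y) (hXc : X.card = t) :
    X ∈ rowsOf S t 𝒞 := by
  rw [mem_rowsOf] at hY ⊢
  exact ⟨⟨hX.trans hY.1.1, hXc⟩, fun C hC hCX => hY.2 C hC (hCX.trans hX)⟩

/-- The rows one level up containing a row `X` correspond to the points `z ∉ X` with `insert z X` a row. -/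
theorem card_up_eq {X : Finset α} (hX : X ∈ rowsOf S t 𝒞) :
    ((S \ X).filter (fun z => insert z X ∈ rowsOf S (t + 1) 𝒞)).card
      = ((rowsOf S (t + 1) 𝒞).filter (fun Y => X ⊆ Y)).card := by
  have hXS : X ⊆ S := (mem_rowsOf.1 hX).1.1
  have hXc : X.card = t := (mem_rowsOf.1 hX).1.2
  rw [← card_image_of_injOn (f := fun z => insert z X)]
  · congr 1
    ext Y
    rw [mem_image, mem_filter]
    constructor
    · rintro ⟨z, hz, rfl⟩
      rw [mem_filter] at hz
      exact ⟨hz.2, subset_insert _ _⟩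
    · rintro ⟨hY, hXY⟩
      have hYc : Y.card = t + 1 := (mem_rowsOf.1 hY).1.2
      have hYS : Y ⊆ S := (mem_rowsOf.1 hY).1.1
      obtain ⟨z, hz⟩ : (Y \ X).Nonempty := by
        rw [← card_pos, card_sdiff_of_subset hXY]; omega
      rw [mem_sdiff] at hz
      refine ⟨z, ?_, ?_⟩
      · rw [mem_filter, mem_sdiff]
        have : insert z X = Y := by
          apply eq_of_subset_of_card_le (insert_subset hz.1 hXY)
          rw [card_insert_of_notMem hz.2, hXc, hYc]
        exact ⟨⟨hYS hz.1, hz.2⟩, by rw [this]; exact hY⟩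
      · apply eq_of_subset_of_card_le (insert_subset hz.1 hXY)
        rw [card_insert_of_notMem hz.2, hXc, hYc]
  · intro z hz z' hz' h
    rw [coe_filter, Set.mem_setOf_eq, mem_sdiff] at hz hz'
    simp only at h
    have : z ∈ insert z' X := by rw [← h]; exact mem_insert_self _ _
    rcases mem_insert.1 this with h1 | h1
    · exact h1
    · exact absurd h1 hz.1.2

/-- Every `t`-subset of a row of level `t + 1` is a row: a row of level `t + 1` contains `t + 1` rows. -/
theorem card_down_eq {Y : Finset α} (hY : Y ∈ rowsOf S (t + 1) 𝒞) :
    ((rowsOf S t 𝒞).filter (fun X => X ⊆ Y)).card = t + 1 := by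
  have hYc : Y.card = t + 1 := (mem_rowsOf.1 hY).1.2
  have : (rowsOf S t 𝒞).filter (fun X => X ⊆ Y) = Y.powersetCard t := by
    ext X
    rw [mem_filter, mem_powersetCard]
    constructor
    · rintro ⟨hX, hXY⟩; exact ⟨hXY, (mem_rowsOf.1 hX).1.2⟩
    · rintro ⟨hXY, hXc⟩; exact ⟨mem_rowsOf_of_subset hY hXY hXc, hXY⟩
  rw [this, card_powersetCard, hYc, Nat.choose_succ_self_right]

/-- The double count: `Σ_X #{z ∉ X : insert z X a row} = (t + 1) · r (t+1)`. -/
theorem sum_up_eq :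
    ∑ X ∈ rowsOf S t 𝒞, ((S \ X).filter (fun z => insert z X ∈ rowsOf S (t + 1) 𝒞)).card
      = (t + 1) * (rowsOf S (t + 1) 𝒞).card := by
  rw [sum_congr rfl (fun X hX => card_up_eq hX)]
  have h1 : ∀ X, ((rowsOf S (t + 1) 𝒞).filter (fun Y => X ⊆ Y)).card
      = ∑ Y ∈ rowsOf S (t + 1) 𝒞, if X ⊆ Y then 1 else 0 := by
    intro X; rw [card_filter]
  simp only [h1]
  rw [sum_comm]
  have h2 : ∀ Y ∈ rowsOf S (t + 1) 𝒞, (∑ X ∈ rowsOf S t 𝒞, if X ⊆ Y then 1 else 0) = t + 1 := by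
    intro Y hY
    rw [← card_filter, card_down_eq hY]
  rw [sum_congr rfl h2, sum_const, smul_eq_mul, mul_comm]

/-- For a row `X`, the points `z ∉ X` with `insert z X` not a row are the missing points of the members one short in
`X` (a disjoint union of singletons). -/
theorem touched_eq_biUnion (hsub : ∀ C ∈ 𝒞, C ⊆ S)
    {X : Finset α} (hX : X ∈ rowsOf S t 𝒞) :
    (S \ X).filter (fun z => insert z X ∉ rowsOf S (t + 1) 𝒞)
      = (𝒞.filter (fun C => (X ∩ C).card + 1 = C.card)).biUnion (fun C => C \ X) := by
  obtain ⟨⟨hXS, hXc⟩, hav⟩ := mem_rowsOf.1 hX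
  ext z
  rw [mem_filter, mem_sdiff, mem_biUnion]
  constructor
  · rintro ⟨⟨hzS, hzX⟩, hnot⟩
    rw [mem_rowsOf] at hnot
    push Not at hnot
    have hins : insert z X ⊆ S ∧ (insert z X).card = t + 1 := by
      refine ⟨insert_subset hzS hXS, ?_⟩
      rw [card_insert_of_notMem hzX, hXc]
    obtain ⟨C, hC, hCz⟩ := hnot hins
    have hzC : z ∈ C := by
      by_contra hzC
      apply hav C hC
      intro x hx
      rcases mem_insert.1 (hCz hx) with rfl | h
      · exact absurd hx hzC
      · exact h
    have hCX : C \ X = {z} := by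
      ext x
      rw [mem_sdiff, mem_singleton]
      constructor
      · rintro ⟨hxC, hxX⟩
        rcases mem_insert.1 (hCz hxC) with h | h
        · exact h
        · exact absurd h hxX
      · rintro rfl; exact ⟨hzC, hzX⟩
    refine ⟨C, ?_, ?_⟩
    · rw [mem_filter]
      refine ⟨hC, ?_⟩
      have h1 := card_sdiff_add_card_inter C X
      rw [hCX, card_singleton, inter_comm] at h1
      omega
    · rw [hCX]; exact mem_singleton_self z
  · rintro ⟨C, hC, hzC⟩
    rw [mem_filter] at hC
    rw [mem_sdiff] at hzC
    have hone : (C \ X).card = 1 := by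
      have := card_sdiff_add_card_inter C X
      rw [inter_comm] at this
      omega
    have hCX : C \ X = {z} := by
      rw [card_eq_one] at hone
      obtain ⟨a, ha⟩ := hone
      have : z ∈ ({a} : Finset α) := by rw [← ha]; exact mem_sdiff.2 hzC
      rw [mem_singleton] at this
      rw [ha, this]
    refine ⟨⟨hsub C hC.1 hzC.1, hzC.2⟩, ?_⟩
    rw [mem_rowsOf]
    rintro ⟨_, hav'⟩
    apply hav' C hC.1
    intro x hx
    rw [mem_insert]
    by_cases hxX : x ∈ X
    · exact Or.inr hxX
    · left
      have : x ∈ C \ X := mem_sdiff.2 ⟨hx, hxX⟩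
      rw [hCX, mem_singleton] at this
      exact this

/-- The completing points of a row are counted by the members one short in it. -/
theorem card_touched_eq (hsub : ∀ C ∈ 𝒞, C ⊆ S) (hpair : ∀ C ∈ 𝒞, ∀ C' ∈ 𝒞, C ≠ C' → Disjoint C C')
    {X : Finset α} (hX : X ∈ rowsOf S t 𝒞) :
    ((S \ X).filter (fun z => insert z X ∉ rowsOf S (t + 1) 𝒞)).card
      = (𝒞.filter (fun C => (X ∩ C).card + 1 = C.card)).card := by
  rw [touched_eq_biUnion hsub hX, card_biUnion]
  · rw [card_eq_sum_ones]
    apply sum_congr rfl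
    intro C hC
    rw [mem_filter] at hC
    have := card_sdiff_add_card_inter C X
    rw [inter_comm] at this
    omega
  · intro C hC C' hC' hne
    rw [mem_coe, mem_filter] at hC hC'
    exact Finset.disjoint_of_subset_left sdiff_subset
      (Finset.disjoint_of_subset_right sdiff_subset (hpair C hC.1 C' hC'.1 hne))

/-- **THE HAZARD IDENTITY.** `(n − t) · r t = (t + 1) · r (t+1) + Σ_{C ∈ 𝒞} #shortRows`. -/
theorem hazard_identity (hsub : ∀ C ∈ 𝒞, C ⊆ S) (hpair : ∀ C ∈ 𝒞, ∀ C' ∈ 𝒞, C ≠ C' → Disjoint C C') :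
    (S.card - t) * (rowsOf S t 𝒞).card
      = (t + 1) * (rowsOf S (t + 1) 𝒞).card + ∑ C ∈ 𝒞, (shortRows S t 𝒞 C).card := by
  -- `Σ_X #(S ∖ X) = (n − t) r t`
  have h1 : ∑ X ∈ rowsOf S t 𝒞, (S \ X).card = (S.card - t) * (rowsOf S t 𝒞).card := by
    rw [sum_congr rfl (fun X hX => by
      rw [card_sdiff_of_subset (mem_rowsOf.1 hX).1.1, (mem_rowsOf.1 hX).1.2]), sum_const, smul_eq_mul, mul_comm]
  -- split each `S ∖ X`
  have h2 : ∀ X ∈ rowsOf S t 𝒞, (S \ X).card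
      = ((S \ X).filter (fun z => insert z X ∈ rowsOf S (t + 1) 𝒞)).card
        + ((S \ X).filter (fun z => insert z X ∉ rowsOf S (t + 1) 𝒞)).card := by
    intro X _
    exact (card_filter_add_card_filter_not _).symm
  rw [← h1, sum_congr rfl h2, sum_add_distrib, sum_up_eq]
  congr 1
  rw [sum_congr rfl (fun X hX => card_touched_eq hsub hpair hX)]
  -- swap the sums
  have h3 : ∀ X, (𝒞.filter (fun C => (X ∩ C).card + 1 = C.card)).card
      = ∑ C ∈ 𝒞, if (X ∩ C).card + 1 = C.card then 1 else 0 := by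
    intro X; rw [card_filter]
  simp only [h3]
  rw [sum_comm]
  apply sum_congr rfl
  intro C _
  unfold shortRows
  rw [card_filter]

end Hazard

section IFR

variable {S : Finset α} {𝒞 : Finset (Finset α)}

/-- The rows one short of `C` are the fibre `#(X ∖ C) = t + 1 − #C` of the decomposition over `C`:
`#shortRows = #C · r' (t + 1 − #C)` with `r'` the rows of the other members on `S ∖ C`. -/
theorem card_shortRows (hsub : ∀ C ∈ 𝒞, C ⊆ S) (hpair : ∀ C ∈ 𝒞, ∀ C' ∈ 𝒞, C ≠ C' → Disjoint C C')
    {C : Finset α} (hC : C ∈ 𝒞) (hCne : C.Nonempty) (t : ℕ) (hCt : C.card ≤ t + 1) :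
    (shortRows S t 𝒞 C).card = C.card * (rowsOf (S \ C) (t + 1 - C.card) (𝒞.erase C)).card := by
  have h𝒞 : 𝒞 = insert C (𝒞.erase C) := (insert_erase hC).symm
  have hdisj : ∀ C' ∈ 𝒞.erase C, Disjoint C' C := by
    intro C' hC'
    rw [mem_erase] at hC'
    exact hpair C' hC'.2 C hC hC'.1
  have hfib : shortRows S t 𝒞 C = (rowsOf S t (insert C (𝒞.erase C))).filter (fun X => (X \ C).card = t + 1 - C.card) := by
    unfold shortRows
    rw [← h𝒞]
    apply filter_congr
    intro X hX
    have hXc := (mem_rowsOf.1 hX).1.2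
    have := card_sdiff_add_card_inter X C
    omega
  have hpos : 0 < C.card := card_pos.2 hCne
  rw [hfib, rows_insert_fiber_eq_image (hsub C hC) hdisj t (t + 1 - C.card) (by omega),
    card_image_of_injOn (rows_insert_injOn (S := S) (C := C) (𝒞 := 𝒞.erase C) t (t + 1 - C.card)), card_product]
  congr 1
  have hk : t - (t + 1 - C.card) = C.card - 1 := by omega
  rw [hk]
  have := card_filter_ne_powersetCard C (C.card - 1)
  unfold truncRow at this
  rw [if_pos ⟨by omega, by omega⟩] at this
  have h2 : ((C.card - 1 : ℕ) : ℤ).toNat = C.card - 1 := by omega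
  have h3 : C.card.choose (C.card - 1) = C.card := by
    rw [← Nat.choose_symm (Nat.sub_le _ _), Nat.sub_sub_self (by omega), Nat.choose_one_right]
  rw [h2, h3] at this
  exact_mod_cast this

/-- No row is short of a member larger than `t + 1`. -/
theorem shortRows_eq_empty {C : Finset α} (t : ℕ) (hCt : t + 1 < C.card) : shortRows S t 𝒞 C = ∅ := by
  unfold shortRows
  rw [filter_eq_empty_iff]
  intro X hX
  have hXc := (mem_rowsOf.1 hX).1.2
  have := card_le_card (inter_subset_left : X ∩ C ⊆ X)
  omega

/-- **The termwise step.** `#shortRows (t+1) · r t ≥ #shortRows t · r (t+1)` for every member. -/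
theorem A_step (hsub : ∀ C ∈ 𝒞, C ⊆ S) (hpair : ∀ C ∈ 𝒞, ∀ C' ∈ 𝒞, C ≠ C' → Disjoint C C')
    {C : Finset α} (hC : C ∈ 𝒞) (hCne : C.Nonempty) (t : ℕ) :
    ((shortRows S t 𝒞 C).card : ℚ) * (rowsOf S (t + 1) 𝒞).card
      ≤ ((shortRows S (t + 1) 𝒞 C).card : ℚ) * (rowsOf S t 𝒞).card := by
  rcases lt_or_ge (t + 1) C.card with hbig | hCt
  · rw [shortRows_eq_empty t hbig]; simp only [card_empty, Nat.cast_zero, zero_mul]; positivity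
  have hpos : 0 < C.card := card_pos.2 hCne
  -- the convolution form of the rows
  have h𝒞 : 𝒞 = insert C (𝒞.erase C) := (insert_erase hC).symm
  have hdisj : ∀ C' ∈ 𝒞.erase C, Disjoint C' C := by
    intro C' hC'
    rw [mem_erase] at hC'
    exact hpair C' hC'.2 C hC hC'.1
  have hconv : rowsSeq S 𝒞 = convSeq (truncRow C.card) (rowsSeq (S \ C) (𝒞.erase C)) := by
    have := rowsSeq_insert (hsub C hC) hdisj
    rwa [← h𝒞] at this
  have hglc : GLC (rowsSeq (S \ C) (𝒞.erase C)) := glc_rowsSeq (𝒞.erase C) (S \ C)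
    (fun C' hC' => by
      rw [mem_erase] at hC'
      rw [subset_sdiff]
      exact ⟨hsub C' hC'.2, hpair C' hC'.2 C hC hC'.1⟩)
    (fun C₁ h₁ C₂ h₂ hne => hpair C₁ (mem_of_mem_erase h₁) C₂ (mem_of_mem_erase h₂) hne)
  -- the short rows in terms of `r' = rowsSeq (S ∖ C) (𝒞.erase C)`
  have hA0 : ((shortRows S t 𝒞 C).card : ℚ)
      = C.card * rowsSeq (S \ C) (𝒞.erase C) ((t + 1 - C.card : ℕ) : ℤ) := by
    rw [card_shortRows hsub hpair hC hCne t hCt]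
    push_cast
    unfold rowsSeq
    rw [if_pos (by omega), Int.toNat_natCast]
  have hA1 : ((shortRows S (t + 1) 𝒞 C).card : ℚ)
      = C.card * rowsSeq (S \ C) (𝒞.erase C) (((t + 1 - C.card : ℕ) : ℤ) + 1) := by
    rw [card_shortRows hsub hpair hC hCne (t + 1) (by omega)]
    push_cast
    unfold rowsSeq
    rw [if_pos (by omega)]
    have e : ((((t + 1 - C.card : ℕ) : ℤ) + 1)).toNat = t + 1 + 1 - C.card := by omega
    rw [e]
  -- the rows in terms of `r'`
  have hr0 : ((rowsOf S t 𝒞).card : ℚ)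
      = ∑ σ ∈ range (t + 1), truncRow C.card (t - σ) * rowsSeq (S \ C) (𝒞.erase C) σ := by
    have hval : rowsSeq S 𝒞 t = ((rowsOf S t 𝒞).card : ℚ) := by
      unfold rowsSeq; rw [if_pos (by omega), Int.toNat_natCast]
    have := congrFun hconv t
    rw [hval] at this
    rw [this]; rfl
  have hr1 : ((rowsOf S (t + 1) 𝒞).card : ℚ)
      = ∑ σ ∈ range (t + 1), truncRow C.card (t - σ) * rowsSeq (S \ C) (𝒞.erase C) (σ + 1) := by
    have e : ((t : ℤ) + 1).toNat = t + 1 := by omega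
    have hval : rowsSeq S 𝒞 ((t : ℤ) + 1) = ((rowsOf S (t + 1) 𝒞).card : ℚ) := by
      unfold rowsSeq; rw [if_pos (by omega), e]
    have := congrFun hconv ((t : ℤ) + 1)
    rw [hval] at this
    rw [this]
    unfold convSeq
    rw [e, sum_range_succ']
    have h0 : truncRow C.card ((t : ℤ) + 1 - ((0 : ℕ) : ℤ)) * rowsSeq (S \ C) (𝒞.erase C) ((0 : ℕ) : ℤ) = 0 := by
      unfold truncRow
      rw [if_neg (fun h => by push_cast at h; omega), zero_mul]
    rw [h0, add_zero]
    apply sum_congr rfl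
    intro σ _
    congr 2
    push_cast; ring
  rw [hA0, hA1, hr0, hr1, mul_sum, mul_sum]
  apply sum_le_sum
  intro σ hσ
  rw [mem_range] at hσ
  have hτ : 0 ≤ truncRow C.card (t - σ) := (glc_truncRow C.card).nonneg _
  rcases lt_or_ge σ (t + 1 - C.card) with hσs | hσs
  · -- the layer `t − σ ≥ #C` is empty
    have : truncRow C.card ((t : ℤ) - σ) = 0 := by
      unfold truncRow
      rw [if_neg (fun h => by omega)]
    rw [this, zero_mul, mul_zero, zero_mul, mul_zero]
  · -- log-concavity of `r'` at `(t + 1 − #C, σ)`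
    have hlc := hglc.lc ((t + 1 - C.card : ℕ) : ℤ) σ (by omega)
    have hCpos : (0 : ℚ) ≤ C.card := Nat.cast_nonneg _
    have h1 : (C.card : ℚ) * rowsSeq (S \ C) (𝒞.erase C) ((t + 1 - C.card : ℕ) : ℤ)
          * (truncRow C.card (t - σ) * rowsSeq (S \ C) (𝒞.erase C) (σ + 1))
        = (C.card : ℚ) * truncRow C.card (t - σ)
          * (rowsSeq (S \ C) (𝒞.erase C) ((t + 1 - C.card : ℕ) : ℤ) * rowsSeq (S \ C) (𝒞.erase C) (σ + 1)) := by ring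
    have h2 : (C.card : ℚ) * rowsSeq (S \ C) (𝒞.erase C) (((t + 1 - C.card : ℕ) : ℤ) + 1)
          * (truncRow C.card (t - σ) * rowsSeq (S \ C) (𝒞.erase C) σ)
        = (C.card : ℚ) * truncRow C.card (t - σ)
          * (rowsSeq (S \ C) (𝒞.erase C) (((t + 1 - C.card : ℕ) : ℤ) + 1) * rowsSeq (S \ C) (𝒞.erase C) σ) := by ring
    rw [h1, h2]
    exact mul_le_mul_of_nonneg_left hlc (mul_nonneg hCpos hτ)

/-- **THEOREM (IFR).** The survival fraction of a pairwise disjoint family is log-concave: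
`(t+2)(n−t) · r t · r (t+2) ≤ (t+1)(n−t−1) · r (t+1)²` for `t + 2 ≤ n`. -/
theorem ifr_rowsOf (hsub : ∀ C ∈ 𝒞, C ⊆ S) (hpair : ∀ C ∈ 𝒞, ∀ C' ∈ 𝒞, C ≠ C' → Disjoint C C')
    (hne : ∀ C ∈ 𝒞, C.Nonempty) (t : ℕ) (ht : t + 2 ≤ S.card) :
    ((rowsOf S t 𝒞).card : ℚ) * (rowsOf S (t + 2) 𝒞).card * (((t : ℚ) + 2) * ((S.card : ℚ) - t))
      ≤ ((rowsOf S (t + 1) 𝒞).card : ℚ) * (rowsOf S (t + 1) 𝒞).card * (((t : ℚ) + 1) * ((S.card : ℚ) - t - 1)) := by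
  set r0 : ℚ := ((rowsOf S t 𝒞).card : ℚ) with hr0
  set r1 : ℚ := ((rowsOf S (t + 1) 𝒞).card : ℚ) with hr1
  set r2 : ℚ := ((rowsOf S (t + 2) 𝒞).card : ℚ) with hr2
  set Q0 : ℚ := ∑ C ∈ 𝒞, ((shortRows S t 𝒞 C).card : ℚ) with hQ0
  set Q1 : ℚ := ∑ C ∈ 𝒞, ((shortRows S (t + 1) 𝒞 C).card : ℚ) with hQ1
  -- the hazard identities at `t` and `t + 1`, in `ℚ`
  have hI0 : ((S.card : ℚ) - t) * r0 = (t + 1) * r1 + Q0 := by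
    have := hazard_identity (S := S) (𝒞 := 𝒞) (t := t) hsub hpair
    have hc : ((S.card - t : ℕ) : ℚ) = (S.card : ℚ) - t := by rw [Nat.cast_sub (by omega)]
    rw [hr0, hr1, hQ0, ← hc]
    exact_mod_cast this
  have hI1 : ((S.card : ℚ) - t - 1) * r1 = (t + 2) * r2 + Q1 := by
    have := hazard_identity (S := S) (𝒞 := 𝒞) (t := t + 1) hsub hpair
    have hc : ((S.card - (t + 1) : ℕ) : ℚ) = (S.card : ℚ) - t - 1 := by rw [Nat.cast_sub (by omega)]; push_cast; ring
    rw [hr1, hr2, hQ1, ← hc]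
    exact_mod_cast this
  -- the termwise step, summed
  have hstep : Q0 * r1 ≤ Q1 * r0 := by
    rw [hQ0, hQ1, sum_mul, sum_mul]
    exact sum_le_sum (fun C hC => A_step hsub hpair hC (hne C hC) t)
  have hQ1nn : 0 ≤ Q1 := sum_nonneg (fun C _ => by positivity)
  have hr0nn : 0 ≤ r0 := by positivity
  have hr1nn : 0 ≤ r1 := by positivity
  -- `(t+1) r1² ≥ (t+2) r0 r2 + r0 r1` from the step, then the theorem from `Q1 ≥ 0`
  have key : (t + 2) * r0 * r2 + r0 * r1 ≤ (t + 1) * r1 * r1 := by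
    have e1 : Q0 = ((S.card : ℚ) - t) * r0 - (t + 1) * r1 := by linarith
    have e2 : Q1 = ((S.card : ℚ) - t - 1) * r1 - (t + 2) * r2 := by linarith
    rw [e1, e2] at hstep
    nlinarith [hstep]
  have hnt : (0 : ℚ) ≤ (S.card : ℚ) - t - 1 := by
    have : (t : ℚ) + 2 ≤ S.card := by exact_mod_cast ht
    linarith
  have hQ1' : (t + 2) * r2 ≤ ((S.card : ℚ) - t - 1) * r1 := by linarith
  nlinarith [key, hQ1', hr0nn, hr1nn, hnt, mul_nonneg hr0nn hnt, mul_nonneg hr0nn hQ1nn]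

end IFR

end PercRepro.PuncturedLYM.Split
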